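import Mathlib
import Summits.NavierStokesRegularity.FluidComputer.AbcInertiaIndexSets

/-!
# INERTIA-3L instantiation, Part 3: the HEAD of the weighted form as a pair of real quadratic forms
# (instab3 g8, cell `ns-blowup`, 2026-08-27)

HONEST FRAMING (human ruling D-0035): nothing here is a claim about Navier–Stokes blow-up.
WHAT THIS IS NOT: not NS evidence. MODEL lane (forced-ABC linearisation, class II, coordinates of
`AbcClassIIDefs`); no certificate, number or census word moves.

For an INERTIA-3L certificate with junction head `H` (a `Finset Idx` with `i ∈ H ↔ |O_i|² ≤ r_H²`), first
tail shell `B` (`r_H² < |O_i|² ≤ (r_H+1)²`) and a real symmetric HEAD WEIGHT `GH` on `H` (the weight operator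
is `(G w)_i = Σ_{j ∈ H} GH i j · w_j` on `H` and `w_i` off `H`; the certificates use `GH = X ⊕ 1`), the finitely
supported part of `⟪G w, (L − a) w⟫` is
`Σ_{i ∈ H} conj((G w)_i) ((L − a) w)_i + Σ_{i ∈ B} conj(w_i) Σ_{j ∈ H} amat i j w_j` (head rows + the
`B → H` couplings of the tail rows). This file proves the purely algebraic identity (no analysis):

  `2 · Re(that) = Q(Re w_H, Re w_B) + Q(Im w_H, Im w_B)`,
  `Q(x, y) = x ⬝ (M₀ x) + 2 · x ⬝ (F₂ y)`, `M₀ = GH·Â_HH + Â_HHᵀ·GH`, `F₂ = GH·amat_HB + (amat_BH)ᵀ`,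
  `Â_HH = [(−|O_i|²/R − a) δ_ij + amat i j]_{i,j ∈ H}`

— the `M₀`, `F₂` of `InertiaJunctionSquare.head_boundary_form_neg` (instab3 g7, p509518) — using only
finite sums, the reality of all matrices (`Re(conj z₁ · z₂) = Re z₁ Re z₂ + Im z₁ Im z₂`) and the (R4) facts
of `AbcInertiaIndexSets` (the `H`-rows of `L` see `H ∪ B` only). §1: generic complex-to-real identities
for real matrices; §2: the head rows of `L − a` in block form; §3: the identity.

Mathlib + `AbcInertiaIndexSets`; no new definitions; std axioms. [folklore]
-/

noncomputable section

open scoped BigOperators ComplexConjugate Matrix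
open Finset Matrix

namespace Summit.NavierStokesRegularity.FluidComputer.AbcInertia

open Literature.Analysis.FunctionSpaces Literature.Analysis.FunctionSpaces.Torus
open Literature.Analysis.FluidPDE
open Summit.NavierStokesRegularity.FluidComputer.AbcClassII

/-! ### §1 Complex-to-real identities for real matrices -/

section RealMatrices

variable {m n : Type*} [Fintype m] [Fintype n]

/-- **Rectangular real bilinear form on complex vectors**:
`Re Σ_i conj(w_i) Σ_j F_ij z_j = (Re w) ⬝ (F (Re z)) + (Im w) ⬝ (F (Im z))`. -/
theorem re_sum_conj_mul_sum (F : Matrix m n ℝ) (w : m → ℂ) (z : n → ℂ) :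
    (∑ i, (starRingEnd ℂ) (w i) * ∑ j, ((F i j : ℝ) : ℂ) * z j).re =
      (fun i => (w i).re) ⬝ᵥ (F *ᵥ fun j => (z j).re) + (fun i => (w i).im) ⬝ᵥ (F *ᵥ fun j => (z j).im) := by
  simp only [dotProduct, Matrix.mulVec, Complex.re_sum, Finset.mul_sum, Complex.mul_re,
    Complex.mul_im, Complex.ofReal_re, Complex.ofReal_im, Complex.conj_re, Complex.conj_im, zero_mul,
    sub_zero, add_zero, ← Finset.sum_add_distrib]
  refine Finset.sum_congr rfl fun i _ => Finset.sum_congr rfl fun j _ => by ring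

/-- `x ⬝ (Mᵀ y) = y ⬝ (M x)`. -/
theorem dotProduct_transpose_mulVec (M : Matrix m n ℝ) (x : n → ℝ) (y : m → ℝ) :
    x ⬝ᵥ (Mᵀ *ᵥ y) = y ⬝ᵥ (M *ᵥ x) := by
  rw [Matrix.mulVec_transpose, dotProduct_comm, ← Matrix.dotProduct_mulVec]

/-- **Square real form on a complex vector, symmetrised**:
`2 Re Σ_i conj(w_i) Σ_j M_ij w_j = (Re w) ⬝ ((M + Mᵀ)(Re w)) + (Im w) ⬝ ((M + Mᵀ)(Im w))`. -/
theorem two_mul_re_sum_conj_mul_sum (M : Matrix m m ℝ) (w : m → ℂ) :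
    2 * (∑ i, (starRingEnd ℂ) (w i) * ∑ j, ((M i j : ℝ) : ℂ) * w j).re =
      (fun i => (w i).re) ⬝ᵥ ((M + Mᵀ) *ᵥ fun j => (w j).re) +
        (fun i => (w i).im) ⬝ᵥ ((M + Mᵀ) *ᵥ fun j => (w j).im) := by
  rw [re_sum_conj_mul_sum, Matrix.add_mulVec, Matrix.add_mulVec, dotProduct_add, dotProduct_add,
    dotProduct_transpose_mulVec, dotProduct_transpose_mulVec]
  ring

/-- **Moving a real symmetric weight across the pairing**: for `GHᵀ = GH`,
`Σ_i conj(Σ_j GH_ij w_j) · (Σ_l P_il z_l) = Σ_j conj(w_j) · Σ_l (GH·P)_jl z_l`. -/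
theorem sum_conj_weight_mul (GH : Matrix m m ℝ) (hGH : GHᵀ = GH) (P : Matrix m n ℝ) (w : m → ℂ)
    (z : n → ℂ) :
    ∑ i, (starRingEnd ℂ) (∑ j, ((GH i j : ℝ) : ℂ) * w j) * ∑ l, ((P i l : ℝ) : ℂ) * z l =
      ∑ j, (starRingEnd ℂ) (w j) * ∑ l, (((GH * P) j l : ℝ) : ℂ) * z l := by
  -- expand both sides into triple sums and compare termwise
  have lhs : ∑ i, (starRingEnd ℂ) (∑ j, ((GH i j : ℝ) : ℂ) * w j) * ∑ l, ((P i l : ℝ) : ℂ) * z l =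
      ∑ i, ∑ j, ∑ l, ((GH i j : ℝ) : ℂ) * (starRingEnd ℂ) (w j) * (((P i l : ℝ) : ℂ) * z l) := by
    refine Finset.sum_congr rfl fun i _ => ?_
    rw [map_sum, Finset.sum_mul]
    refine Finset.sum_congr rfl fun j _ => ?_
    rw [map_mul, Complex.conj_ofReal, Finset.mul_sum]
  have rhs : ∑ j, (starRingEnd ℂ) (w j) * ∑ l, (((GH * P) j l : ℝ) : ℂ) * z l =
      ∑ j, ∑ i, ∑ l, ((GH i j : ℝ) : ℂ) * (starRingEnd ℂ) (w j) * (((P i l : ℝ) : ℂ) * z l) := by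
    refine Finset.sum_congr rfl fun j _ => ?_
    rw [Finset.mul_sum]
    have e : ∀ l, (starRingEnd ℂ) (w j) * ((((GH * P) j l : ℝ) : ℂ) * z l) =
        ∑ i, ((GH i j : ℝ) : ℂ) * (starRingEnd ℂ) (w j) * (((P i l : ℝ) : ℂ) * z l) := by
      intro l
      rw [Matrix.mul_apply]
      push_cast
      rw [Finset.sum_mul, Finset.mul_sum]
      refine Finset.sum_congr rfl fun i _ => ?_
      have hji : GH j i = GH i j := by
        have := congrFun (congrFun hGH i) j
        rwa [Matrix.transpose_apply] at this
      rw [hji]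
      ring
    rw [Finset.sum_congr rfl fun l _ => e l, Finset.sum_comm]
  rw [lhs, rhs, Finset.sum_comm]

/-- `Re(conj z · r · z) = r ‖z‖²` for real `r` (with `‖z‖² = (Re z)² + (Im z)²`). -/
theorem re_conj_mul_ofReal_mul (z : ℂ) (r : ℝ) : ((starRingEnd ℂ) z * (((r : ℝ) : ℂ) * z)).re = r * ‖z‖ ^ 2 := by
  rw [Complex.sq_norm, Complex.normSq_apply]
  simp [Complex.mul_re, Complex.mul_im]
  ring

end RealMatrices

/-! ### §2 The head rows of `L − a` in block form -/

section Head

variable {R a rL rH : ℝ} (h0 : 0 ≤ rL) (hLH : rL + 1 ≤ rH)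
variable {HL HH HB : Finset Idx}
variable (hHL : ∀ i : Idx, i ∈ HL ↔ onormSq i.1 ≤ rL ^ 2)
variable (hHH : ∀ i : Idx, i ∈ HH ↔ onormSq i.1 ≤ rH ^ 2)
variable (hHB : ∀ i : Idx, i ∈ HB ↔ rH ^ 2 < onormSq i.1 ∧ onormSq i.1 ≤ (rH + 1) ^ 2)

include h0 hLH hHH hHB in
/-- **The `H`-rows of the first-order matrix see `H ∪ B` only**: for `i ∈ H`,
`Σ_{j ∈ nbrIdx i} amat i j w_j = Σ_{j ∈ H} amat i j w_j + Σ_{l ∈ B} amat i l w_l`. -/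
theorem rowSum_eq_of_mem_HH (w : Idx → ℂ) {i : Idx} (hi : i ∈ HH) :
    ∑ j ∈ nbrIdx i, ((amat i j : ℝ) : ℂ) * w j =
      ∑ j ∈ HH, ((amat i j : ℝ) : ℂ) * w j + ∑ l ∈ HB, ((amat i l : ℝ) : ℂ) * w l := by
  classical
  rw [← Finset.sum_union (disjoint_HH_HB hHH hHB)]
  -- both sides are the sum over `nbrIdx i ∩ (H ∪ B)`; the rest vanishes
  rw [← Finset.sum_filter_add_sum_filter_not (nbrIdx i) (fun j => j ∈ HH ∪ HB),
    ← Finset.sum_filter_add_sum_filter_not (HH ∪ HB) (fun j => j ∈ nbrIdx i)]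
  have h1 : ∑ j ∈ (nbrIdx i).filter (fun j => j ∉ HH ∪ HB), ((amat i j : ℝ) : ℂ) * w j = 0 := by
    refine Finset.sum_eq_zero fun j hj => ?_
    obtain ⟨hjn, hjU⟩ := Finset.mem_filter.mp hj
    exfalso; apply hjU
    by_cases hjH : j ∈ HH
    · exact Finset.mem_union_left _ hjH
    · exact Finset.mem_union_right _ (mem_HB_of_mem_nbrIdx_of_mem_HH h0 hLH hHH hHB hi hjn hjH)
  have h2 : ∑ j ∈ (HH ∪ HB).filter (fun j => j ∉ nbrIdx i), ((amat i j : ℝ) : ℂ) * w j = 0 := by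
    refine Finset.sum_eq_zero fun j hj => ?_
    rw [amat_eq_zero_of_not_mem (Finset.mem_filter.mp hj).2]; simp
  rw [h1, h2, add_zero, add_zero]
  refine Finset.sum_congr ?_ fun _ _ => rfl
  ext j
  simp only [Finset.mem_filter]
  tauto

/-- **Row sums against the indicator of `H` are the plain `H`-sums** (used for the `B`-rows of the
tail): `Σ_{j ∈ nbrIdx i} amat i j (𝟙_H w)_j = Σ_{j ∈ H} amat i j w_j` (any `i`). -/
theorem rowSum_indicator_eq (w : Idx → ℂ) (i : Idx) :
    ∑ j ∈ nbrIdx i, ((amat i j : ℝ) : ℂ) * (if j ∈ HH then w j else 0) =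
      ∑ j ∈ HH, ((amat i j : ℝ) : ℂ) * w j := by
  classical
  rw [← Finset.sum_filter_add_sum_filter_not (nbrIdx i) (fun j => j ∈ HH),
    ← Finset.sum_filter_add_sum_filter_not HH (fun j => j ∈ nbrIdx i)]
  have h1 : ∑ j ∈ (nbrIdx i).filter (fun j => j ∉ HH), ((amat i j : ℝ) : ℂ) * (if j ∈ HH then w j else 0) = 0 :=
    Finset.sum_eq_zero fun j hj => by rw [if_neg (Finset.mem_filter.mp hj).2, mul_zero]
  have h2 : ∑ j ∈ HH.filter (fun j => j ∉ nbrIdx i), ((amat i j : ℝ) : ℂ) * w j = 0 :=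
    Finset.sum_eq_zero fun j hj => by rw [amat_eq_zero_of_not_mem (Finset.mem_filter.mp hj).2]; simp
  rw [h1, h2, add_zero, add_zero]
  refine Finset.sum_congr ?_ fun j hj => by rw [if_pos (Finset.mem_filter.mp hj).1]
  ext j
  simp only [Finset.mem_filter]
  tauto

end Head

/-! ### §3 The head identity -/

section HeadIdentity

variable {R a rL rH : ℝ} (h0 : 0 ≤ rL) (hLH : rL + 1 ≤ rH)
variable {HL HH HB : Finset Idx}
variable (hHL : ∀ i : Idx, i ∈ HL ↔ onormSq i.1 ≤ rL ^ 2)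
variable (hHH : ∀ i : Idx, i ∈ HH ↔ onormSq i.1 ≤ rH ^ 2)
variable (hHB : ∀ i : Idx, i ∈ HB ↔ rH ^ 2 < onormSq i.1 ∧ onormSq i.1 ≤ (rH + 1) ^ 2)
variable (GH Ah : Matrix ↥HH ↥HH ℝ) (AHB : Matrix ↥HH ↥HB ℝ) (ABH : Matrix ↥HB ↥HH ℝ)
variable (hGH : GHᵀ = GH)
variable (hAh : Ah = Matrix.of fun i j : ↥HH =>
  (if i = j then -(onormSq i.1.1 / R) - a else 0) + amat i.1 j.1)
variable (hAHB : AHB = Matrix.of fun (i : ↥HH) (l : ↥HB) => amat i.1 l.1)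
variable (hABH : ABH = Matrix.of fun (l : ↥HB) (i : ↥HH) => amat l.1 i.1)

include h0 hLH hHH hHB hAh hAHB in
/-- **The head rows of `(L − a) w` in block form**: for `i ∈ H`,
`((L − a) w)_i = Σ_{j : H} Â_ij w_j + Σ_{l : B} amat i l · w_l`. -/
theorem headRow_eq (w : Idx → ℂ) (i : ↥HH) :
    ((-(onormSq i.1.1 / R) : ℝ) : ℂ) * w i.1 + ∑ j ∈ nbrIdx i.1, ((amat i.1 j : ℝ) : ℂ) * w j -
        ((a : ℝ) : ℂ) * w i.1 =
      ∑ j : ↥HH, ((Ah i j : ℝ) : ℂ) * w j.1 + ∑ l : ↥HB, ((AHB i l : ℝ) : ℂ) * w l.1 := by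
  classical
  rw [rowSum_eq_of_mem_HH h0 hLH hHH hHB w i.2, hAh, hAHB]
  simp only [Matrix.of_apply]
  rw [← Finset.sum_coe_sort HH, ← Finset.sum_coe_sort HB]
  have hdiag : ∑ j : ↥HH, (((if i = j then -(onormSq i.1.1 / R) - a else 0 : ℝ) : ℂ)) * w j.1 =
      (((-(onormSq i.1.1 / R) - a : ℝ)) : ℂ) * w i.1 := by
    rw [Finset.sum_eq_single i]
    · rw [if_pos rfl]
    · intro j _ hji; rw [if_neg (Ne.symm hji)]; simp
    · intro h; exact absurd (Finset.mem_univ i) h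
  have hsplit : ∑ j : ↥HH, (((if i = j then -(onormSq i.1.1 / R) - a else 0 : ℝ) + amat i.1 j.1 : ℝ) : ℂ) * w j.1 =
      ∑ j : ↥HH, (((if i = j then -(onormSq i.1.1 / R) - a else 0 : ℝ) : ℂ)) * w j.1 +
        ∑ j : ↥HH, ((amat i.1 j.1 : ℝ) : ℂ) * w j.1 := by
    rw [← Finset.sum_add_distrib]
    refine Finset.sum_congr rfl fun j _ => ?_
    push_cast; ring
  rw [hsplit, hdiag]
  push_cast
  ring

include h0 hLH hHH hHB hGH hAh hAHB hABH in
/-- **THE HEAD IDENTITY.** For every coefficient vector `w : Idx → ℂ`, with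
`(G w)_i = Σ_{j : H} GH i j w_j` (`i ∈ H`):
`2 Re [Σ_{i : H} conj((G w)_i) ((L − a) w)_i + Σ_{i : B} conj(w_i) Σ_{j ∈ H} amat i j w_j]`
`= Q(Re w_H, Re w_B) + Q(Im w_H, Im w_B)`, `Q(x, y) = x ⬝ (M₀ x) + 2 x ⬝ (F₂ y)`,
`M₀ = GH Â + Âᵀ GH`, `F₂ = GH amat_HB + (amat_BH)ᵀ`. -/
theorem two_mul_re_head_eq (w : Idx → ℂ) :
    2 * (∑ i : ↥HH, (starRingEnd ℂ) (∑ j : ↥HH, ((GH i j : ℝ) : ℂ) * w j.1) *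
          (((-(onormSq i.1.1 / R) : ℝ) : ℂ) * w i.1 + ∑ j ∈ nbrIdx i.1, ((amat i.1 j : ℝ) : ℂ) * w j -
            ((a : ℝ) : ℂ) * w i.1) +
        ∑ i : ↥HB, (starRingEnd ℂ) (w i.1) * ∑ j ∈ HH, ((amat i.1 j : ℝ) : ℂ) * w j).re =
      ((fun i : ↥HH => (w i.1).re) ⬝ᵥ ((GH * Ah + Ahᵀ * GH) *ᵥ fun i : ↥HH => (w i.1).re) +
          2 * ((fun i : ↥HH => (w i.1).re) ⬝ᵥ ((GH * AHB + ABHᵀ) *ᵥ fun l : ↥HB => (w l.1).re))) +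
        ((fun i : ↥HH => (w i.1).im) ⬝ᵥ ((GH * Ah + Ahᵀ * GH) *ᵥ fun i : ↥HH => (w i.1).im) +
          2 * ((fun i : ↥HH => (w i.1).im) ⬝ᵥ ((GH * AHB + ABHᵀ) *ᵥ fun l : ↥HB => (w l.1).im))) := by
  classical
  -- block form of the head rows
  have hrow : ∀ i : ↥HH, ((-(onormSq i.1.1 / R) : ℝ) : ℂ) * w i.1 +
      ∑ j ∈ nbrIdx i.1, ((amat i.1 j : ℝ) : ℂ) * w j - ((a : ℝ) : ℂ) * w i.1 =
      ∑ j : ↥HH, ((Ah i j : ℝ) : ℂ) * w j.1 + ∑ l : ↥HB, ((AHB i l : ℝ) : ℂ) * w l.1 :=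
    fun i => headRow_eq h0 hLH hHH hHB Ah AHB hAh hAHB w i
  simp_rw [hrow, mul_add, Finset.sum_add_distrib]
  -- move the weight across: `Σ conj(GH w_H)·(Ah w_H) = Σ conj(w_H)·(GH Ah w_H)` etc.
  rw [sum_conj_weight_mul GH hGH Ah (fun j : ↥HH => w j.1) (fun j : ↥HH => w j.1),
    sum_conj_weight_mul GH hGH AHB (fun j : ↥HH => w j.1) (fun l : ↥HB => w l.1)]
  -- the `B`-rows as a Fintype sum with the matrix `ABH`
  have hB : ∑ i : ↥HB, (starRingEnd ℂ) (w i.1) * ∑ j ∈ HH, ((amat i.1 j : ℝ) : ℂ) * w j =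
      ∑ i : ↥HB, (starRingEnd ℂ) (w i.1) * ∑ j : ↥HH, ((ABH i j : ℝ) : ℂ) * w j.1 := by
    refine Finset.sum_congr rfl fun i _ => ?_
    rw [← Finset.sum_coe_sort HH, hABH]
    rfl
  rw [hB]
  -- real parts
  rw [Complex.add_re, Complex.add_re, mul_add, mul_add,
    two_mul_re_sum_conj_mul_sum (GH * Ah) (fun j : ↥HH => w j.1),
    re_sum_conj_mul_sum (GH * AHB) (fun j : ↥HH => w j.1) (fun l : ↥HB => w l.1),
    re_sum_conj_mul_sum ABH (fun i : ↥HB => w i.1) (fun j : ↥HH => w j.1)]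
  -- `(GH Ah)ᵀ = Ahᵀ GH`, `x_B ⬝ (ABH x_H) = x_H ⬝ (ABHᵀ x_B)`
  have ht : (GH * Ah)ᵀ = Ahᵀ * GH := by rw [Matrix.transpose_mul, hGH]
  rw [ht, ← dotProduct_transpose_mulVec ABH (fun j : ↥HH => (w j.1).re) (fun i : ↥HB => (w i.1).re),
    ← dotProduct_transpose_mulVec ABH (fun j : ↥HH => (w j.1).im) (fun i : ↥HB => (w i.1).im)]
  simp only [Matrix.add_mulVec, dotProduct_add]
  ring

end HeadIdentity

end Summit.NavierStokesRegularity.FluidComputer.AbcInertia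

end
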